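import Summits.Ventures.QEC.Census.CertInfoSetOrbitStab
import Summits.Ventures.QEC.Census.CertTwoBlockShiftSound
import Summits.Ventures.QEC.Census.CertInfoSetOrbitFastSound
import HarnessLib

/-!
# Orbit-STABILIZED information sets — soundness (qec-search-4 g6; companion of `Census/CertInfoSetOrbitStab.lean`)

* `orbit_lower_sound_mask` — the landed double count (`orbit_lower_sound_abs`, qec-search-4 g4) with multiplicities
  counted against an arbitrary column set `M_s` per view and the per-view obligation abstracted to `MaskCovers`;
  `orbit_lower_soundM` — its instance for the INVERSES of word automorphisms with the fast masked class table
  (`orbitProfileOKM`), exactly as `orbit_lower_soundF`.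
* `maskCovers_of_reaches` — the landed per-view replay (`Reaches` of all `≤ t` selections, `M = freeMask`) discharges
  `MaskCovers`; `maskCovers_of_stab` — a STABILIZED view's canonical forced-base-point families (`TopReaches`, one per
  orbit label) discharge `MaskCovers` (the argument of the companion file's header).
* The certificate-level wrappers (`DistCert.lowZ_of_orbitM` …, producer wrappers) and the `[[4,2,2]]` end-to-end control
  are in `Census/CertInfoSetOrbitStabCert.lean` (400-line rule).
HONEST FRAMING: no certificate is read and no distance is asserted here; tier KERNEL, axioms ⊆ {propext, Classical.choice,
Quot.sound}; no `native_decide`. [folklore]  Reuses by name: qec-search-4 `orbit_transport` / `countB_*` / `profGo_sound`,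
qec-type-01 `countB_suppIdx_comp_symm` / `xorFst_lt_of_sublist_rowPos` / `xorList_map_filter` / `suppIdx_sublist_range`,
qec-search-7 `eq_ofBits_freeSupp`, qec-type-12 `wordEquiv_val` / `testBit_wordApplyL_symm`.
-/

set_option autoImplicit false

namespace Summit.Ventures.QEC.Census

open Matrix Literature.InformationTheory.QuantumCodes

/-! ## 1. The masked double count (abstract automorphism family) -/

section Abstract

variable {n : ℕ} {Hsyn Hstab : List ℕ}

/-- **Masked orbit averaging, abstract family.**  `q` row-map automorphisms `σ_i` tabulated by `f i`, views with
depths, one column set `M_s` (bitmask) per view with `MaskCovers` discharged for each, multiplicities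
`mult s x = #{i < q : σ_i x ∈ M_s}` constant on the classes of `cls` with table `μ`, and the passing profile recursion
⇒ every non-trivial logical has weight `> wmax`.  (The landed `orbit_lower_sound_abs` with `M_s = free_s` abstracted.) -/
theorem orbit_lower_sound_mask (hcomm : rowMatrix n Hsyn * (rowMatrix n Hstab)ᵀ = 0)
    (q : ℕ) (σ : ℕ → (Fin n ≃ Fin n)) (f : ℕ → ℕ → ℕ) (hf : ∀ i, i < q → ∀ x : Fin n, f i x = ((σ i x : Fin n) : ℕ))
    (hσX : ∀ i, i < q → ∃ ρ : Fin Hsyn.length → Fin Hsyn.length, (rowMatrix n Hsyn).submatrix ρ (σ i) = rowMatrix n Hsyn)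
    (hσZ : ∀ i, i < q →
      ∃ ρ : Fin Hstab.length → Fin Hstab.length, (rowMatrix n Hstab).submatrix ρ (σ i) = rowMatrix n Hstab)
    {views : List OrbitView} {wmax : ℕ} (masks : List ℕ)
    (hcov : ∀ s, s < views.length → MaskCovers n Hsyn Hstab wmax (masks.getD s 0) (views.getD s dfltView).t)
    (mult : ℕ → ℕ → ℕ)
    (hmult : ∀ s, s < views.length → ∀ x : Fin n,
      mult s x = countB (fun i => (masks.getD s 0).testBit (f i x)) (List.range q))
    {cls : List ℕ} {μ : List (List ℕ)}
    (hcls : ∀ x, x < n → cls.getD x 0 < μ.length ∧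
      ∀ s, s < views.length → mult s x = (μ.getD (cls.getD x 0) []).getD s 0)
    (hgo : profGo μ (classSizes n μ.length cls) wmax 0 (List.replicate views.length 0) (orbBounds q views) = true)
    (w : Fin n → ZMod 2) (hw : rowMatrix n Hsyn *ᵥ w = 0) (hw' : w ∉ rowSpace (rowMatrix n Hstab)) :
    wmax < hammingNorm w := by
  by_contra hle
  rw [not_lt] at hle
  set L := suppIdx n w with hL
  have hLlen : L.length = hammingNorm w := by
    have := length_suppList n [] w
    rwa [suppList, List.length_map] at this
  have hw0 : w ≠ 0 := fun h0 => hw' (h0 ▸ Submodule.zero_mem _)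
  have hLpos : 0 < L.length := by rw [hLlen]; exact hammingNorm_pos_iff.2 hw0
  have hLlt : ∀ x ∈ L, x < n := fun x hx => lt_of_mem_suppIdx n w hx
  have hLsub : L.Sublist (List.range n) := suppIdx_sublist_range w
  set m := μ.length with hm
  set ps := profileOf cls m L with hps
  have hclsL : ∀ x ∈ L, cls.getD x 0 < m := fun x hx => (hcls x (hLlt x hx)).1
  have hpslen : ps.length = μ.length := length_profileOf cls m L
  have hpssum : ps.sum = L.length := sum_profileOf cls m L hclsL
  have hpscap : ∀ j, j < μ.length → ps.getD j 0 ≤ (classSizes n m cls).getD j 0 := by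
    intro j hj
    rw [hps, getD_profileOf _ _ _ hj, classSizes, List.getD_eq_getElem?_getD, List.getElem?_map,
      List.getElem?_range hj, Option.map_some, Option.getD_some]
    exact countB_le_of_sublist _ hLsub
  rcases profGo_sound μ (classSizes n m cls) wmax 0 (List.replicate views.length 0) (orbBounds q views) hgo
      ps hpslen hpscap (by rw [hpssum, hLlen]; exact hle) with h0 | ⟨s, hs1, hs2, hlt⟩
  · omega
  rw [List.length_replicate] at hs1
  set V := views.getD s dfltView with hV
  set M := masks.getD s 0 with hM
  have hacc : (List.replicate views.length 0).getD s 0 = 0 := by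
    rw [List.getD_eq_getElem?_getD, List.getElem?_replicate, if_pos hs1, Option.getD_some]
  have hbnd : (orbBounds q views).getD s 0 = q * (V.t + 1) := by
    rw [orbBounds, List.getD_eq_getElem?_getD, List.getElem?_map, List.getElem?_eq_getElem hs1, Option.map_some,
      Option.getD_some, hV, List.getD_eq_getElem?_getD, List.getElem?_eq_getElem hs1, Option.getD_some]
  rw [hacc, hbnd, zero_add] at hlt
  have hsumL : (L.map fun x => mult s x).sum = profSum ps μ s := by
    rw [sum_map_eq_profSum_aux cls m (fun x => mult s x) (fun j => (μ.getD j []).getD s 0) L hclsL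
      (fun x hx => (hcls x (hLlt x hx)).2 s hs1), profSum]
    refine congrArg List.sum (List.map_congr_left fun j hj => ?_)
    rw [List.mem_range] at hj
    rw [hps, getD_profileOf _ _ _ hj]
  have hswap := sum_countB_swap (fun i x => M.testBit (f i x)) (List.range q) L
  have hmultL : ∀ x ∈ L, mult s x = countB (fun i => M.testBit (f i x)) (List.range q) := fun x hx =>
    hmult s hs1 ⟨x, hLlt x hx⟩
  have hlt' : ((List.range q).map fun i => countB (fun x => M.testBit (f i x)) L).sum <
      (List.range q).length * (V.t + 1) := by
    rw [hswap, List.length_range, ← List.map_congr_left hmultL, hsumL]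
    exact hlt
  obtain ⟨i, hi, hile⟩ := exists_le_of_sum_lt _ V.t (List.range q) hlt'
  rw [List.mem_range] at hi
  let C : CSSCode (Fin Hsyn.length) (Fin Hstab.length) (Fin n) :=
    CSSCode.ofMatrices (rowMatrix n Hsyn) (rowMatrix n Hstab) hcomm
  obtain ⟨ρX, hXsub⟩ := hσX i hi
  obtain ⟨ρZ, hZsub⟩ := hσZ i hi
  obtain ⟨hz1, hz2⟩ := C.zLogical_comp_equiv_symm_of_rowMap hXsub hZsub ⟨hw, hw'⟩
  have hz3 : hammingNorm (w ∘ (σ i).symm) = hammingNorm w := hammingNorm_comp_equiv w _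
  have hcnt : countB (fun j => M.testBit j) (suppIdx n (w ∘ (σ i).symm)) ≤ V.t := by
    rw [countB_suppIdx_comp_symm (σ i) w (fun j => M.testBit j) (f i) (hf i hi)]
    exact hile
  have := hcov s hs1 _ hz1 hz2 hcnt
  rw [hz3] at this
  omega

end Abstract

/-! ## 2. The fast masked lane -/

section Fast

variable {n : ℕ} {Hsyn Hstab : List ℕ}

/-- **Soundness of the fast masked lane (one side)**: generator / word checks (type-12 fast), the masked profile check,
and `MaskCovers` for every view ⇒ `wmax < |w|` for every non-trivial logical.  The automorphisms averaged over are the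
INVERSES of the listed words (as in `orbit_lower_soundF`). -/
theorem orbit_lower_soundM (hcomm : rowMatrix n Hsyn * (rowMatrix n Hstab)ᵀ = 0)
    {gens : List AutGen} (hgens : autGensOKFast n Hsyn Hstab gens = true)
    {words : List (List ℕ)} (hwords : autWordsOK gens.length words = true)
    {views : List OrbitView} {masks : List ℕ} {wmax : ℕ}
    (hcov : ∀ s, s < views.length → MaskCovers n Hsyn Hstab wmax (masks.getD s 0) (views.getD s dfltView).t)
    {cls : List ℕ} {μ : List (List ℕ)}
    (hprof : orbitProfileOKM n wmax (autPerms gens) words masks views cls μ = true)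
    (w : Fin n → ZMod 2) (hw : rowMatrix n Hsyn *ᵥ w = 0) (hw' : w ∉ rowSpace (rowMatrix n Hstab)) :
    wmax < hammingNorm w := by
  have hgens' := autGensOK_of_fast hgens
  have hng : (autPerms gens).length = gens.length := List.length_map ..
  have hperm : ∀ g ∈ autPerms gens, permListOK n g = true := permListOK_of_autGensOK hgens'
  have hwd : ∀ i, i < words.length → ∀ g ∈ words.getD i [], g < (autPerms gens).length := fun i hi => by
    rw [hng, List.getD_eq_getElem?_getD, List.getElem?_eq_getElem hi, Option.getD_some]
    exact lt_of_autWordsOK hwords (List.getElem_mem hi)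
  simp only [orbitProfileOKM, Bool.and_eq_true] at hprof
  obtain ⟨⟨-, hmt⟩, hgo⟩ := hprof
  simp only [multTabOKM, Bool.and_eq_true, beq_iff_eq, List.all_eq_true, List.mem_range, decide_eq_true_eq] at hmt
  obtain ⟨⟨-, hcb⟩, hmt⟩ := hmt
  let σ : ℕ → (Fin n ≃ Fin n) := fun i => (wordEquiv n (autPerms gens) (words.getD i [])).symm
  let f : ℕ → ℕ → ℕ := fun i x => if h : x < n then ((σ i ⟨x, h⟩ : Fin n) : ℕ) else 0
  refine orbit_lower_sound_mask hcomm words.length σ f (fun i _ x => by simp [f, x.2]) ?_ ?_ masks hcov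
    (fun s x => countMasks (viewMasksM n (autPerms gens) words (masks.getD s 0)) x) ?_ ?_ hgo w hw hw'
  · intro i hi
    exact exists_submatrix_symm _ _ (exists_submatrix_eq_wordEquiv (H := Hsyn) hperm
      (rowMapOK_syn_of_autGensOK hgens') _ (hwd i hi))
  · intro i hi
    exact exists_submatrix_symm _ _ (exists_submatrix_eq_wordEquiv (H := Hstab) hperm
      (rowMapOK_stab_of_autGensOK hgens') _ (hwd i hi))
  · intro s hs x
    rw [countMasks_eq]
    have hlen : (viewMasksM n (autPerms gens) words (masks.getD s 0)).length = words.length := by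
      rw [viewMasksM, List.length_map]
    rw [hlen]
    refine countB_congr _ _ _ fun i hi => ?_
    rw [List.mem_range] at hi
    have hwi := hwd i hi
    have hgi : words.getD i [] = words[i] := by
      rw [List.getD_eq_getElem?_getD, List.getElem?_eq_getElem hi, Option.getD_some]
    rw [hgi] at hwi
    rw [viewMasksM, List.getD_eq_getElem?_getD, List.getElem?_map, List.getElem?_eq_getElem hi, Option.map_some,
      Option.getD_some, testBit_wordApplyL_symm hperm _ hwi _]
    simp only [f, σ, Fin.is_lt, dif_pos, Fin.eta, hgi]
  · intro x hx
    exact ⟨hcb x hx, fun s hs => (hmt s hs x hx)⟩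

end Fast

/-! ## 3. Producers of `MaskCovers` -/

section Producers

variable {n : ℕ} {Hsyn Hstab : List ℕ}

/-- **The landed replay discharges `MaskCovers` for the free mask**: with the RREF certificate and the allow-list
decompositions, `Reaches (bzLeaf wmax allow) (rowPos kerBasis 0) t 0 0` ⇒ `MaskCovers … (freeMaskOf n piv) t`
(the tail of qec-search-4 g4's `orbit_lower_sound`). -/
theorem maskCovers_of_reaches {found : List (ℕ × List ℕ)} (hfound : foundOK Hstab found = true) (V : OrbitView)
    (hI : infoSetStructOK n Hsyn V.ic = true) {wmax : ℕ}
    (hreach : Reaches (bzLeaf wmax (found.map Prod.fst)) (rowPos (kerBasis n V.ic.piv V.ic.red) 0) V.t 0 0) :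
    MaskCovers n Hsyn Hstab wmax (freeMaskOf n V.ic.piv) V.t := by
  intro z hz1 hz2 hcnt
  have hI' := hI
  simp only [infoSetStructOK, Bool.and_eq_true] at hI'
  have hfree : (freeSupp n V.ic.piv z).length ≤ V.t := by
    refine le_trans (le_of_eq ?_) hcnt
    rw [freeSupp, length_filter_eq_countB]
    refine countB_congr _ _ _ fun j hj => ?_
    exact (testBit_freeMaskOf V.ic.piv ⟨j, lt_of_mem_suppIdx n z hj⟩).symm
  have hdec := eq_ofBits_freeSupp (Hsyn := Hsyn) hI'.1 hI'.2 hz1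
  set S' := (freeSupp n V.ic.piv z).map (kerVec V.ic.piv V.ic.red) with hS'
  have hS'sub : S'.Sublist (kerBasis n V.ic.piv V.ic.red) := freeSupp_map_sublist_kerBasis z
  have hS'ne : S' ≠ [] := by
    intro he
    rw [he, xorList, ofBits_zero] at hdec
    exact hz2 (hdec ▸ Submodule.zero_mem _)
  have hS'len : S'.length ≤ V.t := by rw [hS', List.length_map]; exact hfree
  have hS'lt : xorList S' < 2 ^ n := by
    refine xorList_lt n S' fun x hx => ?_
    rw [hS', List.mem_map] at hx
    obtain ⟨j, hj, rfl⟩ := hx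
    exact kerVec_lt_two_pow hI'.1 (lt_of_mem_freeSupp z hj)
  obtain ⟨S, hSsub, hSx, hSlen, -, hSne⟩ := exists_rowPos_sublist _ 0 S' hS'sub
  have hleaf := hreach S hSsub (by rw [hSlen]; exact hS'len)
  rw [Nat.zero_xor, Nat.zero_xor, bzLeaf, hSx] at hleaf
  simp only [Bool.or_eq_true, beq_iff_eq] at hleaf
  rcases hleaf with (h0 | hwt) | hmem
  · exact absurd h0 (hSne hS'ne)
  · have := lt_popc_of_wtGt n wmax _ hS'lt hwt
    rw [← hammingNorm_ofBits, ← hdec] at this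
    exact this
  · exfalso
    apply hz2
    rw [hdec]
    obtain ⟨e, he, hex⟩ : ∃ e ∈ found, e.1 = xorList S' := by
      simpa [List.mem_map] using List.mem_of_elem_eq_true hmem
    simp only [foundOK, List.all_eq_true, beq_iff_eq] at hfound
    rw [← hex, ← hfound e he]
    exact ofBits_xorRows_mem_rowSpace n Hstab e.2

/-- **A stabilized view's canonical families discharge `MaskCovers`.**  See the companion file's header: translate the
logical by the mover of the label-minimal `F`-point of its support; the translate is a non-trivial logical of the same
weight whose free support contains the base point and lies in the canonical columns of that label, has `≤ t` elements,
and is therefore read by one forced-top-row verdict. -/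
theorem maskCovers_of_stab (hcomm : rowMatrix n Hsyn * (rowMatrix n Hstab)ᵀ = 0) {found : List (ℕ × List ℕ)}
    (hfound : foundOK Hstab found = true)
    {gens : List AutGen} (hgens : autGensOK n Hsyn Hstab gens = true)
    (v : StabView) (hI : infoSetStructOK n Hsyn v.ic = true)
    (hv : v.stabOK n (autPerms gens) gens.length = true) {wmax : ℕ}
    (hfam : 0 < v.t → ∀ j, j < v.norb →
      TopReaches (bzLeaf wmax (found.map Prod.fst)) (v.canonRows n j) (v.baseRow j) (v.t - 1)) :
    MaskCovers n Hsyn Hstab wmax v.mask v.t := by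
  intro z hz1 hz2 hcnt
  obtain ⟨hwords, hfreeF, hmov⟩ := v.stabOK_spec hv
  have hI' := hI
  simp only [infoSetStructOK, Bool.and_eq_true] at hI'
  -- (a) the free support of `z` is nonempty; an `F`-point of the support with minimal label
  have hdec0 := eq_ofBits_freeSupp (Hsyn := Hsyn) hI'.1 hI'.2 hz1
  have hne : freeSupp n v.ic.piv z ≠ [] := by
    intro he
    rw [he, List.map_nil, xorList, ofBits_zero] at hdec0
    exact hz2 (hdec0 ▸ Submodule.zero_mem _)
  obtain ⟨y0, hy0⟩ := List.exists_mem_of_ne_nil _ hne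
  set LF := (suppIdx n z).filter (fun y => v.mask.testBit y) with hLF
  have hy0LF : y0 ∈ LF := by
    rw [hLF, List.mem_filter]
    refine ⟨List.mem_of_mem_filter hy0, hfreeF y0 (lt_of_mem_freeSupp z hy0) ?_⟩
    rw [isFree, free_of_mem_freeSupp z hy0]; rfl
  obtain ⟨x, hxLF, hxmin⟩ :=
    LF.toFinset.exists_min_image (fun y => v.orb.getD y 0) ⟨y0, List.mem_toFinset.2 hy0LF⟩
  rw [List.mem_toFinset] at hxLF
  have hxsupp : x ∈ suppIdx n z := List.mem_of_mem_filter hxLF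
  have hxM : v.mask.testBit x = true := by have := (List.mem_filter.1 hxLF).2; simpa using this
  have hxn : x < n := lt_of_mem_suppIdx n z hxsupp
  have hzx : z ⟨x, hxn⟩ ≠ 0 := (mem_suppIdx_iff n z ⟨x, hxn⟩).1 hxsupp
  -- (b) the mover of `x`
  obtain ⟨hj, hbn, hbfree, -, hbx, hMinv, horbinv⟩ := v.moverOK_spec (hmov x hxn hxM)
  have hwdlt : ∀ g ∈ v.mv.getD x [], g < gens.length := by
    intro g hg
    by_cases hxl : x < v.mv.length
    · have hval : v.mv.getD x [] = v.mv[x] := by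
        rw [List.getD_eq_getElem?_getD, List.getElem?_eq_getElem hxl, Option.getD_some]
      rw [hval] at hg
      exact lt_of_autWordsOK hwords (List.getElem_mem hxl) g hg
    · rw [List.getD_eq_getElem?_getD, List.getElem?_eq_none (not_lt.1 hxl), Option.getD_none] at hg
      simp at hg
  have hperm : ∀ g ∈ autPerms gens, permListOK n g = true := permListOK_of_autGensOK hgens
  have hwdlt' : ∀ g ∈ v.mv.getD x [], g < (autPerms gens).length := by rw [List.length_map]; exact hwdlt
  set σ := wordEquiv n (autPerms gens) (v.mv.getD x []) with hσ
  have hval : ∀ q : Fin n, permFun (v.mvTab n (autPerms gens) x) q = ((σ q : Fin n) : ℕ) :=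
    fun q => wordEquiv_val hperm _ hwdlt' q
  obtain ⟨hz1', hz2', hz3'⟩ := orbit_transport hcomm hgens hwdlt z hz1 hz2
  set z' := z ∘ σ.symm with hz'
  set j := v.orb.getD x 0 with hjdef
  set b := v.base.getD j 0 with hbdef
  have hσx : σ ⟨x, hxn⟩ = ⟨b, hbn⟩ := Fin.ext (by rw [← hval]; exact hbx)
  -- (c) the base point is in the free support of `z'`
  have hbz' : z' ⟨b, hbn⟩ ≠ 0 := by
    show z (σ.symm ⟨b, hbn⟩) ≠ 0
    rw [← hσx, Equiv.symm_apply_apply]; exact hzx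
  have hbmem : b ∈ freeSupp n v.ic.piv z' := (mem_freeSupp_iff z' ⟨b, hbn⟩).2 ⟨hbz', hbfree⟩
  -- (d) every free support point of `z'` has label `≥ j`
  have hlab : ∀ y' ∈ freeSupp n v.ic.piv z', j ≤ v.orb.getD y' 0 := by
    intro y' hy'
    have hy'n := lt_of_mem_freeSupp z' hy'
    obtain ⟨hzy', hy'free⟩ := (mem_freeSupp_iff z' ⟨y', hy'n⟩).1 hy'
    have hy'M : v.mask.testBit y' = true := hfreeF y' hy'n (by rw [isFree, hy'free]; rfl)
    set y := σ.symm ⟨y', hy'n⟩ with hy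
    have hσy : permFun (v.mvTab n (autPerms gens) x) y = y' := by rw [hval y, hy, Equiv.apply_symm_apply]
    have hyM : v.mask.testBit y = true := by rw [← hMinv y y.2, hσy]; exact hy'M
    have hyLF : (y : ℕ) ∈ LF := by
      rw [hLF, List.mem_filter]
      exact ⟨(mem_suppIdx_iff n z y).2 hzy', by simpa using hyM⟩
    have := hxmin y (List.mem_toFinset.2 hyLF)
    rw [← horbinv y y.2 hyM, hσy] at this
    exact this
  -- (e) the free support of `z'` has `≤ t` elements, so `t ≥ 1`
  have hlen : (freeSupp n v.ic.piv z').length ≤ v.t := by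
    have h1 : (freeSupp n v.ic.piv z').length ≤ countB (fun y => v.mask.testBit y) (suppIdx n z') := by
      rw [← length_filter_eq_countB]
      have heq : freeSupp n v.ic.piv z' = (freeSupp n v.ic.piv z').filter fun y => v.mask.testBit y := by
        refine (List.filter_eq_self.2 fun y hy => ?_).symm
        exact hfreeF y (lt_of_mem_freeSupp z' hy) (by rw [isFree, free_of_mem_freeSupp z' hy]; rfl)
      rw [heq]
      exact (List.filter_sublist.filter _).length_le
    have h2 : countB (fun y => v.mask.testBit y) (suppIdx n z') =
        countB (fun y => v.mask.testBit y) (suppIdx n z) := by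
      rw [hz', countB_suppIdx_comp_symm σ z (fun y => v.mask.testBit y)
        (permFun (v.mvTab n (autPerms gens) x)) hval]
      exact countB_congr _ _ _ fun y hy => hMinv y (lt_of_mem_suppIdx n z hy)
    omega
  have htpos : 0 < v.t := lt_of_lt_of_le (List.length_pos_of_mem hbmem) hlen
  -- (f) the rest of the free support lies in the canonical columns of family `j`
  have hnd : (freeSupp n v.ic.piv z').Nodup := nodup_freeSupp z'
  set S'' := (freeSupp n v.ic.piv z').erase b with hS''
  have hS''sub : S''.Sublist (v.canonCols n j) := by
    have hsub1 : S''.Sublist (List.range n) :=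
      ((List.erase_sublist ..).trans List.filter_sublist).trans (suppIdx_sublist_range z')
    have hall : ∀ y ∈ S'', (!(v.ic.piv.elem y) && decide (j ≤ v.orb.getD y 0) && !(y == b)) = true := by
      intro y hy
      have hyne : y ≠ b := fun h => hnd.not_mem_erase (h ▸ hy)
      have hy' : y ∈ freeSupp n v.ic.piv z' := List.mem_of_mem_erase hy
      have h1 : v.ic.piv.elem y = false := free_of_mem_freeSupp z' hy'
      have h2 : decide (j ≤ v.orb.getD y 0) = true := decide_eq_true (hlab y hy')
      have h3 : (y == b) = false := beq_eq_false_iff_ne.2 hyne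
      rw [h1, h2, h3]; rfl
    rw [StabView.canonCols, ← List.filter_eq_self.2 hall]
    exact hsub1.filter _
  -- (g) the word of `z'` = forced row ⊕ the canonical part
  have hsplit : xorList ((freeSupp n v.ic.piv z').map (kerVec v.ic.piv v.ic.red)) =
      v.baseRow j ^^^ xorList (S''.map (kerVec v.ic.piv v.ic.red)) := by
    rw [xorList_map_filter (kerVec v.ic.piv v.ic.red) (fun y => y == b) (freeSupp n v.ic.piv z')]
    have h1 : (freeSupp n v.ic.piv z').filter (fun y => y == b) = [b] := by
      rw [List.filter_beq, List.count_eq_one_of_mem hnd hbmem, List.replicate_one]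
    have h2 : (freeSupp n v.ic.piv z').filter (fun y => !(y == b)) = S'' := by
      rw [hS'', hnd.erase_eq_filter b]; rfl
    rw [h1, h2, List.map_singleton, xorList, xorList, Nat.xor_zero]
    rfl
  -- (h) the verdict of family `j`
  have hrows : (S''.map (kerVec v.ic.piv v.ic.red)).Sublist (v.canonRows n j) := hS''sub.map _
  obtain ⟨S, hSsub, hSx, hSlen, -, -⟩ := exists_rowPos_sublist (v.canonRows n j) 0 _ hrows
  have hS''len : S''.length ≤ v.t - 1 := by
    rw [hS'', List.length_erase_of_mem hbmem]; omega
  have hleaf := hfam htpos j hj S hSsub (by rw [hSlen, List.length_map]; exact hS''len)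
  have hword_lt : xorList ((freeSupp n v.ic.piv z').map (kerVec v.ic.piv v.ic.red)) < 2 ^ n :=
    xorList_lt n _ fun u hu => by
      obtain ⟨y, hy, rfl⟩ := List.mem_map.1 hu
      exact kerVec_lt_two_pow hI'.1 (lt_of_mem_freeSupp z' hy)
  have hdec := eq_ofBits_freeSupp (Hsyn := Hsyn) hI'.1 hI'.2 hz1'
  have hc : xorSnd S ^^^ v.baseRow j = xorList ((freeSupp n v.ic.piv z').map (kerVec v.ic.piv v.ic.red)) := by
    rw [hsplit, hSx, Nat.xor_comm]
  rw [bzLeaf, hc] at hleaf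
  simp only [Bool.or_eq_true, beq_iff_eq] at hleaf
  rcases hleaf with (h0 | hwt) | hmem
  · exfalso
    have hlt := xorFst_lt_of_sublist_rowPos (v.canonRows n j) hSsub
    have hb := congrArg (fun u => u.testBit (v.canonRows n j).length) h0
    simp only [Nat.testBit_xor, Nat.testBit_two_pow_self, Nat.testBit_lt_two_pow hlt, Nat.zero_testBit] at hb
    simp at hb
  · have := lt_popc_of_wtGt n wmax _ hword_lt hwt
    rw [← hammingNorm_ofBits, ← hdec, hz3'] at this
    exact this
  · exfalso
    apply hz2'
    rw [hdec]
    obtain ⟨e, he, hex⟩ : ∃ e ∈ found, e.1 = xorList ((freeSupp n v.ic.piv z').map (kerVec v.ic.piv v.ic.red)) := by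
      simpa [List.mem_map] using List.mem_of_elem_eq_true hmem
    simp only [foundOK, List.all_eq_true, beq_iff_eq] at hfound
    rw [← hex, ← hfound e he]
    exact ofBits_xorRows_mem_rowSpace n Hstab e.2

end Producers

end Summit.Ventures.QEC.Census
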